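import Mathlib
import Summits.MatrixMultiplication.MatrixMultiplication.Theses.ObstructionDescent

set_option linter.dupNamespace false

/-!
# The split glue of the degree split of `MultiplicityDecides` on `route-MatrixMultiplication-ObstructionDescent`

Item `stmt-MatrixMultiplication-30891` (`MultiplicityDecidesGlue : NoPolyDegreeObstruction → JointBlindnessDecides →
MultiplicityDecides`, rev 3 `71c3db321872`): the two children of the declared residual `MultiplicityDecides`
(`E = NoPolyDegreeObstruction`, `B = JointBlindnessDecides := NoMultiplicityObstruction ∧ NoPolyDegreeObstruction →
RankEventuallyQuadratic`) imply the parent (`MultiplicityDecides := NoMultiplicityObstruction → RankEventuallyQuadratic`).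
Pure logic; sorry-free.  (decomp-mm lens 3, gen 8 kernel `DegreeFiltration_g8_tree.lean` Part 5; landed gen 9.)
-/

namespace Summit.MatrixMultiplication.MatrixMultiplication.Theorems.ObstructionDescentDegreeSplit

open Summit.MatrixMultiplication.MatrixMultiplication.Theses.ObstructionDescent

/-- **item stmt-MatrixMultiplication-30891** `MultiplicityDecidesGlue`: the children imply the parent. -/
theorem multiplicityDecidesGlue_holds : MultiplicityDecidesGlue :=
  fun e b pm => b ⟨pm, e⟩

end Summit.MatrixMultiplication.MatrixMultiplication.Theorems.ObstructionDescentDegreeSplit
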